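import Literature.ModelTheory.ExponentialFields.MacintyreWilkie
import HarnessLib

/-!
# Macintyre–Wilkie, conditional half: reduction to an r.e. set of true axioms for `Th_∃(ℝ_exp)`

Family `periods` (periods.S27), topic `Literature/ModelTheory/ExponentialFields`, in support of
the named fact `Literature.ModelTheory.ExponentialFields.macintyre_wilkie` (`RealExpField.lean`;
Macintyre–Wilkie 1996, Thm. 1.1: `SchanuelProperty ℝ → RealExpDecidable`) and of its conditional
half `Literature.ModelTheory.ExponentialFields.macintyreWilkie_existential_of_schanuelProperty`
(`MacintyreWilkie.lean`: under the real Schanuel property, `Th_∃(ℝ_exp)` is computably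
axiomatizable).

In Macintyre–Wilkie's proof (as transposed verbatim to `x ↦ x^α` by Jones–Servi 2011, §3, whose
proof "proceeds as in [MW96]"), the conditional half is established in the following shape:
every existential sentence true in `ℝ_exp` is a *consequence* of a recursive (indeed: recursively
enumerable suffices, by Craig's theorem) set of sentences true in `ℝ_exp` — there, their
recursive subtheory `T` (Jones–Servi 2011, Thm. 3.7: "Suppose that `ℝ^α ⊨ ∃x̄ ∈ V^{reg}(F)`. Then
`T ⊢ ∃x̄ ∈ V^{reg}(F)`"; Thm. 3.11: "Assume that `α` is generic [the Schanuel condition]. Let `g`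
… be such that `ℝ^α ⊨ ∃x̄ g(x̄) = 0`. Then `T ⊢ ∃x̄ g(x̄) = 0`"; Lemma 3.3: every existential
sentence is equivalent to one of the form `∃x̄ g(x̄) = 0`).  This file **proves** the purely
logical passage from that shape to the vendored named facts, for an arbitrary structure `M` in a
recursively presented language and then for `ℝ_exp`:

* `FirstOrder.Language.Theory.IsREAxioms.union` (proved): r.e. sets of axioms are closed under
  union (so a recursive `T₀` plus an r.e. scheme is r.e.).
* `FirstOrder.Language.Theory.isREAxioms_existentialTheory_of_models` (proved): if an r.e. set
  `Z ⊆ Th(M)` has `Z ⊨ φ` for every `φ ∈ Th_∃(M)`, then `Th_∃(M)` is itself an r.e. set of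
  sentences (`Th_∃(M) = {φ existential | A ⊨ φ}` for Craig's recursive `A`, and consequences of a
  recursive set are r.e. — the enumerability theorem, proved in `DecidableTheoryProofs.lean` —
  while existential sentences are recognisable, `ProofTheory/ExistentialCodes.lean`); hence
  (`…isComputablyAxiomatizable_existentialTheory_of_models`) computably axiomatizable.
* `FirstOrder.Language.Theory.exists_isRecursive_subset_completeTheory_of_isREAxioms` (proved):
  an r.e. `Z ⊆ Th(M)` may be replaced by a *recursive* `A ⊆ Th(M)` with the same consequences
  (Craig's theorem, `ProofTheory/CraigAxiomatization.lean`, plus soundness).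
* For `ℝ_exp` (proved, corollaries over an explicit `Z`, resp. `T₀ ∪ S`):
  `Literature.ModelTheory.ExponentialFields.realExpExistentialTheory_isREAxioms_of_models` /
  `…_of_union` (conclusion `realExpExistentialTheory.IsREAxioms`),
  `Literature.ModelTheory.ExponentialFields.macintyreWilkie_existential_of_schanuelProperty_of_models`
  (the conditional half from: *under `SchanuelProperty ℝ` some r.e. `Z ⊆ Th(ℝ_exp)` proves
  `Th_∃(ℝ_exp)`* — an entry point only, since `Z = Th_∃(ℝ_exp)` shows the hypothesis is
  equivalent to the r.e. reading `macintyreWilkie_existential_of_schanuelProperty_iff_re`), and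
  `Literature.ModelTheory.ExponentialFields.macintyre_wilkie_of_recursiveSubtheory_of_reModels`
  (with the unconditional half `macintyreWilkie_recursiveSubtheory`, via
  `macintyre_wilkie_of_recursiveSubtheory_of_existential_consequences`).

No new definition or named fact is introduced (the r.e.-ness of `Th_∃(ℝ_exp)` is the tree's
`realExpExistentialTheory.IsREAxioms`).  The mathematical content of the conditional half —
Macintyre–Wilkie's §§4–5: under the Schanuel property, a recursive true theory (plus, optionally,
an r.e. scheme of true sentences) proving every true existential sentence, by Newton
approximation (`Literature/Analysis/Calculus/SimplifiedNewton.lean`), Wilkie's desingularisation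
theorem (JAMS 1996, Thm. 5.1) and the Schanuel/Jacobian argument — is what remains.

## References

* A. Macintyre, A. J. Wilkie, *On the decidability of the real exponential field*, in:
  Kreiseliana, A K Peters (1996), 441–467, Thm. 1.1 and §§4–5.
* G. O. Jones, T. Servi, *On the decidability of the real field with a generic power function*,
  J. Symb. Log. 76 (2011), §3: Lemma 3.3, Thm. 3.7, Thm. 3.11.
* W. Craig, *On axiomatizability within a system*, J. Symb. Log. 18 (1953).
* H. B. Enderton, *A Mathematical Introduction to Logic*, 2nd ed. (2001), §3.4–3.5.
-/

universe u v w

open FirstOrder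

namespace FirstOrder.Language.Theory

variable {L : Language.{u, v}} [Encodable (Σ i, L.Functions i)] [Encodable (Σ i, L.Relations i)]

/-- r.e. predicates on `ℕ` are closed under disjunction (run both semi-deciders in parallel:
Mathlib's `Partrec.merge'`, `Partrec.dom_re`). [folklore] -/
theorem _root_.REPred.or {p q : ℕ → Prop} (hp : REPred p) (hq : REPred q) :
    REPred fun n => p n ∨ q n := by
  obtain ⟨k, hk, hk'⟩ := Partrec.merge' hp hq
  refine (Partrec.dom_re hk).of_eq fun n => ?_
  rw [(hk' n).2]
  simp [Part.assert]

/-- The union of two r.e. sets of sentences is an r.e. set of sentences (deliberate dot-notation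
extension of the tree's `Theory.IsREAxioms`, `DecidableTheory.lean`). [folklore] -/
theorem IsREAxioms.union {T T' : L.Theory} (h : T.IsREAxioms) (h' : T'.IsREAxioms) :
    (T ∪ T').IsREAxioms := by
  refine (REPred.or h h').of_eq fun n => ⟨?_, ?_⟩
  · rintro (⟨φ, hφ, hn⟩ | ⟨φ, hφ, hn⟩)
    exacts [⟨φ, Set.mem_union_left _ hφ, hn⟩, ⟨φ, Set.mem_union_right _ hφ, hn⟩]
  · rintro ⟨φ, hφ | hφ, hn⟩
    exacts [Or.inl ⟨φ, hφ, hn⟩, Or.inr ⟨φ, hφ, hn⟩]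

variable {M : Type w} [L.Structure M] [Nonempty M]

omit [Encodable (Σ i, L.Functions i)] [Encodable (Σ i, L.Relations i)] in
/-- **Soundness bookkeeping**: a consequence of a set of sentences true in `M` is true in `M`,
i.e. lies in `Th(M)`. [folklore] -/
theorem mem_completeTheory_of_models {Z : L.Theory} (hZ : Z ⊆ L.completeTheory M)
    {φ : L.Sentence} (h : Z ⊨ᵇ φ) : φ ∈ L.completeTheory M := by
  have : M ⊨ Z := Theory.Model.mono (L.model_completeTheory (M := M)) hZ
  exact mem_completeTheory.2 (h.realize_sentence M)

/-- **Craig's theorem inside a complete theory**: in a recursively presented language, an r.e. set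
`Z` of sentences true in `M` can be replaced by a *recursive* set `A` of sentences true in `M`
with exactly the same consequences (Craig's recursive axiomatization `A` of `Z` consists of
consequences of `Z`, hence of true sentences). [cite: Craig1953] -/
theorem exists_isRecursive_subset_completeTheory_of_isREAxioms (hL : L.IsRecursivelyPresented)
    {Z : L.Theory} (hZ : Z ⊆ L.completeTheory M) (hre : Z.IsREAxioms) :
    ∃ A : L.Theory, A ⊆ L.completeTheory M ∧ A.IsRecursive ∧ ∀ φ : L.Sentence, A ⊨ᵇ φ ↔ Z ⊨ᵇ φ := by
  obtain ⟨A, hA, hAZ⟩ := hre.isComputablyAxiomatizable hL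
  refine ⟨A, fun ψ hψ => ?_, hA, hAZ⟩
  exact mem_completeTheory_of_models hZ ((hAZ ψ).1 (models_sentence_of_mem hψ))

/-- **If an r.e. set of true sentences proves every true existential sentence, then the
existential theory is r.e.** For `Z ⊆ Th(M)` r.e. with `Z ⊨ φ` for all `φ ∈ Th_∃(M)`:
`Th_∃(M) = {φ existential | A ⊨ φ}` for Craig's recursive `A` (same consequences as `Z`; the
inclusion `⊇` is soundness), and this set is r.e. by the enumerability theorem
(`IsComputablyAxiomatizable.isRE_holds`) and the recognisability of existential sentences
(`ExistentialCodes.lean`). This is the logical form of the last step of Macintyre–Wilkie's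
conditional half (Jones–Servi 2011, §3: "it is enough to recursively axiomatize its existential
fragment", achieved by Thms. 3.7 and 3.11 there). [folklore] -/
theorem isREAxioms_existentialTheory_of_models (hL : L.IsRecursivelyPresented) {Z : L.Theory}
    (hZ : Z ⊆ L.completeTheory M) (hre : Z.IsREAxioms)
    (hgen : ∀ φ ∈ L.existentialTheory M, Z ⊨ᵇ φ) : (L.existentialTheory M).IsREAxioms := by
  obtain ⟨A, -, hA, hAZ⟩ := exists_isRecursive_subset_completeTheory_of_isREAxioms hL hZ hre
  have hAre : A.IsRE := IsComputablyAxiomatizable.isRE_holds hL hA.isComputablyAxiomatizable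
  have hex := Literature.ModelTheory.ProofTheory.PreFOL.computablePred_exists_isExistential_godelNumber_eq
    (L := L) hL.computable_arityF hL.computable_arityR
  refine (REPred.computable_and hex hAre).of_eq fun n => ⟨?_, ?_⟩
  · rintro ⟨⟨φ, hφ, hn⟩, ⟨ψ, hψ, hn'⟩⟩
    obtain rfl : φ = ψ := Sentence.godelNumber_injective (hn.trans hn'.symm)
    have hM : M ⊨ φ := mem_completeTheory.1 (mem_completeTheory_of_models hZ ((hAZ φ).1 hψ))
    exact ⟨φ, ⟨hφ, hM⟩, hn⟩
  · rintro ⟨φ, hφ, hn⟩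
    exact ⟨⟨φ, hφ.1, hn⟩, ⟨φ, (hAZ φ).2 (hgen φ hφ), hn⟩⟩

/-- Under the same hypotheses `Th_∃(M)` is computably axiomatizable (Craig). [folklore] -/
theorem isComputablyAxiomatizable_existentialTheory_of_models (hL : L.IsRecursivelyPresented)
    {Z : L.Theory} (hZ : Z ⊆ L.completeTheory M) (hre : Z.IsREAxioms)
    (hgen : ∀ φ ∈ L.existentialTheory M, Z ⊨ᵇ φ) :
    (L.existentialTheory M).IsComputablyAxiomatizable :=
  (isREAxioms_existentialTheory_of_models hL hZ hre hgen).isComputablyAxiomatizable hL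

/-- And there is a *recursive* set of true sentences proving every true existential sentence. [folklore] -/
theorem exists_isRecursive_models_existentialTheory (hL : L.IsRecursivelyPresented)
    {Z : L.Theory} (hZ : Z ⊆ L.completeTheory M) (hre : Z.IsREAxioms)
    (hgen : ∀ φ ∈ L.existentialTheory M, Z ⊨ᵇ φ) :
    ∃ A : L.Theory, A ⊆ L.completeTheory M ∧ A.IsRecursive ∧
      ∀ φ ∈ L.existentialTheory M, A ⊨ᵇ φ := by
  obtain ⟨A, hAM, hA, hAZ⟩ := exists_isRecursive_subset_completeTheory_of_isREAxioms hL hZ hre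
  exact ⟨A, hAM, hA, fun φ hφ => (hAZ φ).2 (hgen φ hφ)⟩

end FirstOrder.Language.Theory

/-! ### The real exponential field -/

noncomputable section

namespace Literature.ModelTheory.ExponentialFields

/-- **`Th_∃(ℝ_exp)` is r.e. as soon as some r.e. set of true sentences proves it.** If
`Z ⊆ Th(ℝ_exp)` is an r.e. set of sentences of which every existential sentence true in `ℝ_exp`
is a consequence, then `realExpExistentialTheory` is an r.e. set of sentences (equivalently,
by `realExpExistentialTheory_isComputablyAxiomatizable_iff_isREAxioms`, computably
axiomatizable).  `Z = Th_∃(ℝ_exp)` shows the hypothesis is also necessary, so this is only a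
convenient entry point: in Macintyre–Wilkie's proof `Z` is their recursive subtheory (or a
recursive true theory plus an r.e. scheme of true sentences, `…_of_union` below). [folklore] -/
theorem realExpExistentialTheory_isREAxioms_of_models {Z : Language.orderedExpRing.Theory}
    (hZ : Z ⊆ realExpTheory) (hre : Z.IsREAxioms)
    (hgen : ∀ φ ∈ realExpExistentialTheory, Z ⊨ᵇ φ) : realExpExistentialTheory.IsREAxioms :=
  Language.Theory.isREAxioms_existentialTheory_of_models
    Language.orderedExpRing.isRecursivelyPresented hZ hre hgen

/-- The same with `Z = T₀ ∪ S`, `T₀ ⊆ Th(ℝ_exp)` recursive and `S ⊆ Th(ℝ_exp)` an r.e. scheme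
(the form in which Macintyre–Wilkie's argument can be run without formalising proofs *inside*
`T₀`: e.g. `S` an r.e. family of true sentences `∃x̄ ∈ V^{reg}(F)`). [folklore] -/
theorem realExpExistentialTheory_isREAxioms_of_union {T₀ S : Language.orderedExpRing.Theory}
    (hT₀ : T₀ ⊆ realExpTheory) (hrec : T₀.IsRecursive) (hS : S ⊆ realExpTheory)
    (hre : S.IsREAxioms) (hgen : ∀ φ ∈ realExpExistentialTheory, (T₀ ∪ S) ⊨ᵇ φ) :
    realExpExistentialTheory.IsREAxioms :=
  realExpExistentialTheory_isREAxioms_of_models (Set.union_subset hT₀ hS)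
    (hrec.isREAxioms.union hre) hgen

/-- An r.e. set of true sentences proving `Th_∃(ℝ_exp)` yields a *recursive* one (Craig), i.e.
the hypothesis `h₁` of `macintyre_wilkie_of_recursiveSubtheory_of_existential_consequences`. [folklore] -/
theorem exists_isRecursive_models_realExpExistentialTheory {Z : Language.orderedExpRing.Theory}
    (hZ : Z ⊆ realExpTheory) (hre : Z.IsREAxioms)
    (hgen : ∀ φ ∈ realExpExistentialTheory, Z ⊨ᵇ φ) :
    ∃ T₁ : Language.orderedExpRing.Theory, T₁ ⊆ realExpTheory ∧ T₁.IsRecursive ∧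
      ∀ φ ∈ realExpExistentialTheory, T₁ ⊨ᵇ φ :=
  Language.Theory.exists_isRecursive_models_existentialTheory
    Language.orderedExpRing.isRecursivelyPresented hZ hre hgen

/-- **The conditional half of Macintyre–Wilkie from the shape its proof provides**: if under
the real Schanuel property some r.e. set of true sentences proves every true existential
sentence of `ℝ_exp`, then `macintyreWilkie_existential_of_schanuelProperty` holds (via the
r.e. reading `macintyreWilkie_existential_of_schanuelProperty_iff_re`). [cite: MacintyreWilkieKreiseliana1996, Thm. 1.1 (conditional half)] -/
theorem macintyreWilkie_existential_of_schanuelProperty_of_models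
    (h : SchanuelProperty ℝ → ∃ Z : Language.orderedExpRing.Theory, Z ⊆ realExpTheory ∧
      Z.IsREAxioms ∧ ∀ φ ∈ realExpExistentialTheory, Z ⊨ᵇ φ) :
    macintyreWilkie_existential_of_schanuelProperty :=
  macintyreWilkie_existential_of_schanuelProperty_iff_re.2 fun hS => by
    obtain ⟨Z, hZ, hre, hgen⟩ := h hS
    exact realExpExistentialTheory_isREAxioms_of_models hZ hre hgen

/-- **Macintyre–Wilkie's Theorem 1.1 from the two halves in the shape their proof provides**:
the recursive subtheory with `T₀ ∪ Th_∃(ℝ_exp) ⊨ Th(ℝ_exp)` (`macintyreWilkie_recursiveSubtheory`)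
and, under the Schanuel property, an r.e. set of true sentences proving `Th_∃(ℝ_exp)`
(`macintyre_wilkie_of_recursiveSubtheory_of_existential_consequences` after Craig). [cite: MacintyreWilkieKreiseliana1996, Thm. 1.1] -/
theorem macintyre_wilkie_of_recursiveSubtheory_of_reModels (hA : macintyreWilkie_recursiveSubtheory)
    (hB : SchanuelProperty ℝ → ∃ Z : Language.orderedExpRing.Theory, Z ⊆ realExpTheory ∧
      Z.IsREAxioms ∧ ∀ φ ∈ realExpExistentialTheory, Z ⊨ᵇ φ) : macintyre_wilkie :=
  macintyre_wilkie_of_recursiveSubtheory_of_existential_consequences hA fun hS => by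
    obtain ⟨Z, hZ, hre, hgen⟩ := hB hS
    exact exists_isRecursive_models_realExpExistentialTheory hZ hre hgen

end Literature.ModelTheory.ExponentialFields

end
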